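import Literature.Topology.FourManifolds.GompfFramedTwistZero
import HarnessLib

/-!
# Gompf's Theorem 4.3 from the framed row move alone: the column move by conjugation by `A`

Sibling proof file of `Literature/Topology/FourManifolds/GompfFramedSpheres.lean`, working towards
the discharge of its named fact `Literature.Topology.FourManifolds.gompf2010_thm43` (R. Gompf, *More
Cappell–Shaneson spheres are standard*, Algebr. Geom. Topol. 10 (2010), Theorem 4.3: the two
Cappell–Shaneson spheres of `A₀` are diffeomorphic).

State of the decomposition. `GompfTheorem43.lean` proves Theorem 4.3 from the leaves W, Cj, F, F₀,
P1, P2; W (`StraighteningInvariance.lean`), Cj (`GompfConjInvariance.lean`), P1, P2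
(`GompfTheorem43Proofs.lean`) are discharged and F₀ follows from F (`GompfFramedTwistZero.lean`,
`gompf2010_thm43_of_framedTwist`), so that Theorem 4.3 rests on the single named fact **F** =
`Literature.Topology.FourManifolds.gompf2010_framedTwist`, the *framed Theorem 2.1* for the Δ-moves
(§4 ¶3: "`X^{τ·σ}_B = X^σ_A`" for `B = Δᵏ A` — the *row move* — and for `B = A Δᵏ` — the *column
move*). This file halves that leaf: **the column move follows from the row move**, by the matrix
identity `A Δᵏ = A (Δᵏ A) A⁻¹` and the conjugation invariance Cj — Gompf's §3 ¶3 "adding any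
multiple of the second row to the third while subtracting the same multiple from the first, *or by
the conjugate operation on the second column*". On framings: conjugating the row-move path
`γ·τ_row` ("`γ`, then the segment from `A` to `Δᵏ A`") by `A` gives *on the nose* the column-move
path built on the conjugate straightening `A γ A⁻¹` ("`A γ A⁻¹`, then the segment from `A` to
`A Δᵏ`", `Literature.Topology.FourManifolds.SmoothMatrixPath.conj_deltaLeft_self_along_eq`), and
**`[A γ A⁻¹] = [γ]`** as straightenings of `A`
(`Literature.Topology.FourManifolds.SmoothMatrixPath.toPath_conj_self_homotopic`: slide the end
point of the family `F_s(t) = γ(s) γ(st) γ(s)⁻¹` along `γ`, `homotopic_slide` of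
`GompfTheorem43.lean`), so that W identifies the two spheres. Hence

* `Literature.Topology.FourManifolds.gompf2010_framedTwist_of_left`: F from its row clause;
* `Literature.Topology.FourManifolds.gompf2010_thm43_of_leftTwist`: Theorem 4.3 from the row clause;
* `Literature.Topology.FourManifolds.nonempty_diffeomorph_sphere_four_of_isCappellShanesonSphereOf_of_leftTwist_AK`:
  Examples 3.1(a) from the row clause and [AK1].

Finally the row clause for all `k ∈ ℤ` is reduced to the **single move `A ↦ Δ A`** (Gompf,
Lemma 2.2: "The general case then follows from the case `k = 1`"): by induction on `k`, applying
the single move to `Δᵏ A` (again in standard form with `det (Δᵏ A - 1) = 1`) and identifying the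
framing classes `[γ]·[seg(A, Δᵏ A)]·[seg(Δᵏ A, Δᵏ⁺¹ A)] = [γ]·[seg(A, Δᵏ⁺¹ A)]` — all these
segments lie on the unipotent line `{(1 + s N) A}` (`N = Δ - 1`, determinant `1`), where a
straight-line homotopy is available
(`Literature.Topology.FourManifolds.PosDetMatrix.homotopic_of_det_pos`,
`Literature.Topology.FourManifolds.mk_segmentPath_trans_of_gompfDelta_zpow_mul`):

* `Literature.Topology.FourManifolds.gompf2010_framedTwist_of_one`: F from the single framed row
  move `gompfSphere B β ≃ₘ gompfSphere (Δ B) (β.deltaLeft 1)` (`B` in standard form,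
  `det (B - 1) = 1`);
* `Literature.Topology.FourManifolds.gompf2010_thm43_of_rowMove_one` and
  `Literature.Topology.FourManifolds.nonempty_diffeomorph_sphere_four_of_isCappellShanesonSphereOf_of_rowMove_one_AK`.

That single framed move — Theorem 2.1 proper for `M = T³`, the linear monodromy `A` and the Dehn
twist `δ ≃ Δ` (fishtail neighbourhood and Lemma 2.2 with `k = 1`) — remains the content of the
named fact F.

## References

* R. E. Gompf, *More Cappell–Shaneson spheres are standard*, Algebr. Geom. Topol. 10 (2010)
  1665–1681, doi:10.2140/agt.2010.10.1665 (arXiv:0908.1914): Thm 2.1 (last sentence of the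
  proof: the second form from the first by a symmetry), §3 ¶3 (row move and "the conjugate
  operation on the second column"), §4 ¶3 (the framed moves `X^{τ·σ}_B = X^σ_A`), Thm 4.3.
  [GompfAGT2010]
-/

open scoped Manifold ContDiff Topology unitInterval
open Set Function Matrix

noncomputable section

namespace Literature.Topology.FourManifolds

universe u

/-! ### Conjugating a straightening of `A` by `A` -/

namespace SmoothMatrixPath

variable {A : Matrix.SpecialLinearGroup (Fin 3) ℤ} (γ : SmoothMatrixPath (slRealMatrix A))

/-- The inverse path of a smooth matrix path is continuous. [folklore] -/
theorem continuous_inv : Continuous γ.inv :=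
  continuous_matrix fun i j ↦ (γ.contDiff_inv_apply i j).continuous

/-- At the end point the inverse path is the real matrix of `A⁻¹`. [folklore] -/
theorem inv_one_eq_slRealMatrix_inv : γ.inv 1 = slRealMatrix A⁻¹ := by
  have h1 : γ.inv 1 * slRealMatrix A = 1 := by
    have := γ.inv_mul 1
    rwa [γ.eq_self 1 le_rfl] at this
  rw [← Matrix.inv_eq_left_inv h1, Matrix.inv_eq_left_inv (slRealMatrix_inv_mul A)]

/-- `γ(s) γ(t) γ(s)⁻¹` has positive determinant. [folklore] -/
theorem det_selfConj_pos (s t : ℝ) : 0 < (γ.toFun s * γ.toFun t * γ.inv s).det := by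
  rw [Matrix.det_mul, Matrix.det_mul, mul_comm (γ.toFun s).det, mul_assoc, ← Matrix.det_mul,
    γ.mul_inv, Matrix.det_one, mul_one]
  exact γ.det_pos t

/-- **Conjugating a straightening of `A` by `A` itself does not change its class**:
`[A γ A⁻¹] = [γ]` as paths from `1` to `A` in `GL⁺(3, ℝ)`. Slide the end point of the family
`F_s(t) = γ(s) γ(s t) γ(s)⁻¹` (a path from `1` to `γ(s)`) along `γ` (`homotopic_slide`):
`F_0 · γ ≃ F_1`, where `F_0` is constant and `F_1 = A γ A⁻¹`. [folklore] -/
theorem toPath_conj_self_homotopic (h : A * A * A⁻¹ = A) :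
    ((γ.conj A).along h).toPath.Homotopic γ.toPath := by
  let F : ∀ s : I, Path (1 : PosDetMatrix 3) (γ.toPath s) := fun s ↦
    { toFun := fun t ↦ ⟨γ.toFun s * γ.toFun (s * t) * γ.inv s, γ.det_selfConj_pos s _⟩
      continuous_toFun := ((continuous_const.mul (γ.continuous.comp (continuous_const.mul
        continuous_subtype_val))).mul continuous_const).subtype_mk _
      source' := by
        ext : 1
        simp only [Set.Icc.coe_zero, mul_zero, γ.eq_one 0 le_rfl, Matrix.mul_one, γ.mul_inv,
          PosDetMatrix.coe_one]
      target' := by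
        ext : 1
        simp only [Set.Icc.coe_one, mul_one, Matrix.mul_assoc, γ.mul_inv, coe_toPath_apply] }
  have hF : Continuous ↿F :=
    (((γ.continuous.comp (continuous_subtype_val.comp continuous_fst)).mul
      (γ.continuous.comp ((continuous_subtype_val.comp continuous_fst).mul
        (continuous_subtype_val.comp continuous_snd)))).mul
      (γ.continuous_inv.comp (continuous_subtype_val.comp continuous_fst))).subtype_mk _
  have hs := homotopic_slide γ.toPath F hF
  have h0 : (F 0).cast rfl γ.toPath.source.symm = Path.refl 1 := by
    refine Path.ext (funext fun t ↦ Subtype.ext ?_)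
    show γ.toFun (0 : I) * γ.toFun ((0 : I) * t) * γ.inv (0 : I) = 1
    rw [Set.Icc.coe_zero, zero_mul, γ.eq_one 0 le_rfl, γ.inv_eq_one le_rfl, Matrix.mul_one,
      Matrix.mul_one]
  have h1 : (F 1).cast rfl γ.toPath.target.symm = ((γ.conj A).along h).toPath := by
    refine Path.ext (funext fun t ↦ Subtype.ext ?_)
    show γ.toFun (1 : I) * γ.toFun ((1 : I) * t) * γ.inv (1 : I) =
      slRealMatrix A * γ.toFun t * slRealMatrix A⁻¹
    rw [Set.Icc.coe_one, one_mul, γ.eq_self 1 le_rfl, γ.inv_one_eq_slRealMatrix_inv]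
  rw [h0, h1] at hs
  exact hs.symm.trans (Path.Homotopic.refl_trans _)

/-! ### The column-move path is the conjugate of the row-move path -/

/-- **`A (γ·τ_row) A⁻¹ = (A γ A⁻¹)·τ_col` on the nose**: conjugating by `A` the path "`γ` followed
by the segment from `A` to `Δᵏ A`" gives "`A γ A⁻¹` followed by the segment from `A` to `A Δᵏ`"
(`A (t Δᵏ + (1 - t) I) A⁻¹ = t A Δᵏ A⁻¹ + (1 - t) I`). [cite: GompfAGT2010, §4 ¶3 (τ the linear path from B to A; linearity is preserved under change of basis)] -/
theorem conj_deltaLeft_self_along_eq (h : A * A * A⁻¹ = A) (k : ℤ)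
    (heq : A * (gompfDelta ^ k * A) * A⁻¹ = A * gompfDelta ^ k) :
    ((γ.deltaLeft k).conj A).along heq = ((γ.conj A).along h).deltaRight k := by
  refine ext_toFun fun θ ↦ ?_
  simp only [along_toFun, conj_toFun, deltaLeft_toFun, deltaRight_toFun]
  rw [← conj_linearPath_slRealMatrix A]
  simp only [Matrix.mul_assoc]
  rw [← Matrix.mul_assoc (slRealMatrix A⁻¹) (slRealMatrix A), slRealMatrix_inv_mul,
    Matrix.one_mul]

/-- **In the fundamental groupoid: `[A (γ·τ_row) A⁻¹] = [γ·τ_col]`**, from the pointwise identity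
and `[A γ A⁻¹] = [γ]`. [cite: GompfAGT2010, §4 ¶3 (τ the linear path from B to A)] -/
theorem toPath_conj_deltaLeft_homotopic_deltaRight (k : ℤ)
    (heq : A * (gompfDelta ^ k * A) * A⁻¹ = A * gompfDelta ^ k) :
    (((γ.deltaLeft k).conj A).along heq).toPath.Homotopic (γ.deltaRight k).toPath := by
  have h : A * A * A⁻¹ = A := mul_inv_cancel_right A A
  rw [γ.conj_deltaLeft_self_along_eq h k heq, ← Path.Homotopic.Quotient.eq]
  have h₁ := ((γ.conj A).along h).mk_toPath_deltaRight k rfl (det_segment_mul_gompfDelta_zpow A k)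
  have h₂ := γ.mk_toPath_deltaRight k rfl (det_segment_mul_gompfDelta_zpow A k)
  rw [along_rfl] at h₁ h₂
  rw [h₁, h₂, Path.Homotopic.Quotient.eq.2 (γ.toPath_conj_self_homotopic h)]

end SmoothMatrixPath

/-! ### F, F₀ and Theorem 4.3 from the row move -/

section LeftMove

/-- **F from its row clause — the column move is the row move conjugated by `A`.** Since
`A Δᵏ = A (Δᵏ A) A⁻¹`: `X^γ_A ≅ X^{γ·τ_row}_{Δᵏ A}` (row move) `≅ X^{A(γ·τ_row)A⁻¹}_{A Δᵏ}` (Cj,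
`GompfConjInvariance.lean`) `≅ X^{γ·τ_col}_{A Δᵏ}` (W, `StraighteningInvariance.lean`, by
`[A (γ·τ_row) A⁻¹] = [γ·τ_col]`). So the framed Theorem 2.1 for the Δ-moves follows from its
first conjunct alone (Gompf 2010, §3 ¶3: the Δ-move changes `A` "by adding any multiple of the
second row to the third while subtracting the same multiple from the first, or by the conjugate
operation on the second column"). [cite: GompfAGT2010, §4 ¶3 (X^{τ·σ}_B = X^σ_A for B = Δᵏ A or A Δᵏ) and §3 ¶3] -/
theorem gompf2010_framedTwist_of_left
    (hF : ∀ (A : Matrix.SpecialLinearGroup (Fin 3) ℤ), IsGompfStandardForm A →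
      ((A : Matrix (Fin 3) (Fin 3) ℤ) - 1).det = 1 →
      ∀ (γ : SmoothMatrixPath (slRealMatrix A)) (k : ℤ),
        Nonempty (gompfSphere A γ ≃ₘ⟮𝓡 4, 𝓡 4⟯ gompfSphere (gompfDelta ^ k * A) (γ.deltaLeft k))) :
    gompf2010_framedTwist := by
  intro A hA hdet γ k
  refine ⟨hF A hA hdet γ k, ?_⟩
  have heq : A * (gompfDelta ^ k * A) * A⁻¹ = A * gompfDelta ^ k := by group
  obtain ⟨e₂⟩ := gompf2010_conj_invariance_holds (gompfDelta ^ k * A) A (γ.deltaLeft k)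
  exact nonempty_diffeomorph_trans (hF A hA hdet γ k) (nonempty_diffeomorph_trans ⟨e₂.symm⟩
    (nonempty_diffeomorph_trans (nonempty_diffeomorph_gompfSphere_along ((γ.deltaLeft k).conj A) heq)
      (gompf2010_straightening_invariance_holds _ _ _
        (γ.toPath_conj_deltaLeft_homotopic_deltaRight k heq))))

/-- **F₀ from the row clause of F** (through `gompf2010_framedTwistZero_of_framedTwist` of
`GompfFramedTwistZero.lean`). [cite: GompfAGT2010, §4 ¶5 (X^{τ·σ}_B = X^σ_A for B = Δ₀ᵏ A or A Δ₀ᵏ)] -/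
theorem gompf2010_framedTwistZero_of_left
    (hF : ∀ (A : Matrix.SpecialLinearGroup (Fin 3) ℤ), IsGompfStandardForm A →
      ((A : Matrix (Fin 3) (Fin 3) ℤ) - 1).det = 1 →
      ∀ (γ : SmoothMatrixPath (slRealMatrix A)) (k : ℤ),
        Nonempty (gompfSphere A γ ≃ₘ⟮𝓡 4, 𝓡 4⟯ gompfSphere (gompfDelta ^ k * A) (γ.deltaLeft k))) :
    gompf2010_framedTwistZero :=
  gompf2010_framedTwistZero_of_framedTwist (gompf2010_framedTwist_of_left hF)

/-- **Gompf 2010, Theorem 4.3, from the framed row move alone**: all `X^σ_{A₀} = gompfSphere A₀ γ`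
are diffeomorphic, given only that `gompfSphere A γ ≃ₘ gompfSphere (Δᵏ A) (γ.deltaLeft k)` for
`A` in standard form with `det (A - 1) = 1` (W, Cj, P1, P2 are proved in the tree, F₀ and the
column clause of F follow from the row clause). [cite: GompfAGT2010, Thm 4.3] -/
theorem gompf2010_thm43_of_leftTwist
    (hF : ∀ (A : Matrix.SpecialLinearGroup (Fin 3) ℤ), IsGompfStandardForm A →
      ((A : Matrix (Fin 3) (Fin 3) ℤ) - 1).det = 1 →
      ∀ (γ : SmoothMatrixPath (slRealMatrix A)) (k : ℤ),
        Nonempty (gompfSphere A γ ≃ₘ⟮𝓡 4, 𝓡 4⟯ gompfSphere (gompfDelta ^ k * A) (γ.deltaLeft k))) :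
    gompf2010_thm43 :=
  gompf2010_thm43_of_framedTwist (gompf2010_framedTwist_of_left hF)

end LeftMove

/-! ### The row move for all `k ∈ ℤ` from the single move `A ↦ Δ A` -/

section StraightLine

variable {m : ℕ} {x y : PosDetMatrix m}

/-- **Straight-line homotopies in `GL⁺`.** Two paths in `GL⁺(m, ℝ)` with the same end points are
homotopic as soon as the straight-line homotopy `(1 - s) p(t) + s q(t)` between them stays in
`GL⁺(m, ℝ)`. [folklore] -/
theorem PosDetMatrix.homotopic_of_det_pos (p q : Path x y)
    (h : ∀ s t : I, 0 < ((1 - (s : ℝ)) • (p t).1 + (s : ℝ) • (q t).1).det) : p.Homotopic q :=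
  ⟨{ toFun := fun st ↦ ⟨(1 - (st.1 : ℝ)) • (p st.2).1 + (st.1 : ℝ) • (q st.2).1, h st.1 st.2⟩
     continuous_toFun := by
       refine Continuous.subtype_mk ?_ _
       exact ((continuous_const.sub (continuous_subtype_val.comp continuous_fst)).smul
         (continuous_subtype_val.comp (p.continuous.comp continuous_snd))).add
         ((continuous_subtype_val.comp continuous_fst).smul
           (continuous_subtype_val.comp (q.continuous.comp continuous_snd)))
     map_zero_left := fun t ↦ by
       ext : 1
       simp
     map_one_left := fun t ↦ by
       ext : 1
       simp
     prop' := fun s t ht ↦ by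
       ext : 1
       simp only [Set.mem_insert_iff, Set.mem_singleton_iff] at ht
       rcases ht with rfl | rfl
       · show (1 - (s : ℝ)) • (p 0).1 + (s : ℝ) • (q 0).1 = (p 0).1
         rw [p.source, q.source, ← add_smul, sub_add_cancel, one_smul]
       · show (1 - (s : ℝ)) • (p 1).1 + (s : ℝ) • (q 1).1 = (p 1).1
         rw [p.target, q.target, ← add_smul, sub_add_cancel, one_smul] }⟩

end StraightLine

section RowLine

variable (A : Matrix.SpecialLinearGroup (Fin 3) ℤ)

/-- The real matrix of `Δᵏ` is the unipotent `!![1, -k, 0; 0, 1, 0; 0, k, 1]`. [cite: GompfAGT2010, §3 (the matrix Δ)] -/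
theorem slRealMatrix_gompfDelta_zpow (k : ℤ) :
    slRealMatrix (gompfDelta ^ k) = !![1, -(k : ℝ), 0; 0, 1, 0; 0, (k : ℝ), 1] := by
  have h := linearPath_slRealMatrix_gompfDelta_zpow k 1
  rwa [linearPath_one, one_mul] at h

/-- **Segments along the unipotent line `{(1 + s N) A}` compose**: for matrices `Δᵃ A`, `Δᵇ A`,
`Δᶜ A` on the line through `A` in the direction of the nilpotent `N = Δ - 1` (a line of matrices of
determinant `1`), the segment from `Δᵃ A` to `Δᵇ A` followed by the segment to `Δᶜ A` is homotopic
in `GL⁺(3, ℝ)` to the segment from `Δᵃ A` to `Δᶜ A` (straight-line homotopy inside the line). [folklore] -/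
theorem mk_segmentPath_trans_of_gompfDelta_zpow_mul {X Y Z : Matrix.SpecialLinearGroup (Fin 3) ℤ}
    {a b c : ℤ} (hX : X = gompfDelta ^ a * A) (hY : Y = gompfDelta ^ b * A)
    (hZ : Z = gompfDelta ^ c * A)
    (hXY : ∀ t ∈ I, 0 < ((1 - t) • (slPoint X).1 + t • (slPoint Y).1).det)
    (hYZ : ∀ t ∈ I, 0 < ((1 - t) • (slPoint Y).1 + t • (slPoint Z).1).det)
    (hXZ : ∀ t ∈ I, 0 < ((1 - t) • (slPoint X).1 + t • (slPoint Z).1).det) :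
    (Path.Homotopic.Quotient.mk (segmentPath (slPoint X) (slPoint Y) hXY)).trans
        (Path.Homotopic.Quotient.mk (segmentPath (slPoint Y) (slPoint Z) hYZ)) =
      Path.Homotopic.Quotient.mk (segmentPath (slPoint X) (slPoint Z) hXZ) := by
  -- the line `L = {U(r) A}` with `U(r) = !![1, -r, 0; 0, 1, 0; 0, r, 1]`
  set L : Set (Matrix (Fin 3) (Fin 3) ℝ) :=
    Set.range fun r : ℝ ↦ !![1, -r, 0; 0, 1, 0; 0, r, 1] * slRealMatrix A with hL
  have hconv : ∀ u ∈ L, ∀ v ∈ L, ∀ τ : ℝ, (1 - τ) • u + τ • v ∈ L := by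
    rintro _ ⟨r, rfl⟩ _ ⟨r', rfl⟩ τ
    refine ⟨(1 - τ) * r + τ * r', ?_⟩
    dsimp only
    rw [← Matrix.smul_mul, ← Matrix.smul_mul, ← Matrix.add_mul]
    congr 1
    ext i j
    fin_cases i <;> fin_cases j <;> simp
    all_goals ring
  have hdet : ∀ u ∈ L, u.det = 1 := by
    rintro _ ⟨r, rfl⟩
    rw [Matrix.det_mul, det_slRealMatrix, mul_one]
    simp [Matrix.det_fin_three]
  have hpt : ∀ {W : Matrix.SpecialLinearGroup (Fin 3) ℤ} {d : ℤ}, W = gompfDelta ^ d * A →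
      (slPoint W).1 ∈ L := by
    rintro W d rfl
    exact ⟨d, by rw [coe_slPoint, slRealMatrix_mul, slRealMatrix_gompfDelta_zpow]⟩
  have hseg : ∀ (u v : PosDetMatrix 3) (huv : ∀ t ∈ I, 0 < ((1 - t) • u.1 + t • v.1).det)
      (τ : I), u.1 ∈ L → v.1 ∈ L → (segmentPath u v huv τ).1 ∈ L := fun u v huv τ hu hv ↦ by
    rw [coe_segmentPath_apply]
    exact hconv _ hu _ hv _
  rw [← Path.Homotopic.Quotient.mk_trans, Path.Homotopic.Quotient.eq]
  refine PosDetMatrix.homotopic_of_det_pos _ _ fun s t ↦ ?_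
  have h1 : (((segmentPath (slPoint X) (slPoint Y) hXY).trans
      (segmentPath (slPoint Y) (slPoint Z) hYZ)) t).1 ∈ L := by
    rw [Path.trans_apply]
    split_ifs
    · exact hseg _ _ _ _ (hpt hX) (hpt hY)
    · exact hseg _ _ _ _ (hpt hY) (hpt hZ)
  have h2 : ((segmentPath (slPoint X) (slPoint Z) hXZ) t).1 ∈ L := hseg _ _ _ _ (hpt hX) (hpt hZ)
  rw [hdet _ (hconv _ h1 _ h2 _)]
  exact one_pos

/-- Transport along `A = B` in the fundamental groupoid: `[γ.along h] = [γ] · [segment A → B]`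
(the segment being constant). [folklore] -/
theorem SmoothMatrixPath.mk_toPath_along {A B : Matrix.SpecialLinearGroup (Fin 3) ℤ}
    (γ : SmoothMatrixPath (slRealMatrix A)) (h : A = B)
    (hAB : ∀ t ∈ I, 0 < ((1 - t) • (slPoint A).1 + t • (slPoint B).1).det) :
    Path.Homotopic.Quotient.mk (γ.along h).toPath =
      (Path.Homotopic.Quotient.mk γ.toPath).trans
        (Path.Homotopic.Quotient.mk (segmentPath (slPoint A) (slPoint B) hAB)) := by
  subst h
  have hconst : segmentPath (slPoint A) (slPoint A) hAB = Path.refl _ := by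
    refine Path.ext (funext fun t ↦ Subtype.ext ?_)
    rw [coe_segmentPath_apply, ← add_smul, sub_add_cancel, one_smul]
    rfl
  rw [hconst, Path.Homotopic.Quotient.mk_refl, Path.Homotopic.Quotient.trans_refl]
  rfl

/-- **One more row move**: `X^{γ·τₖ}_{Δᵏ A} ≅ X^{γ·τₖ₊₁}_{Δᵏ⁺¹ A}` from the single move `B ↦ Δ B`
applied to `B = Δᵏ A` (again in standard form with `det (B - 1) = 1`), transported along
`Δ (Δᵏ A) = Δᵏ⁺¹ A`, the framing classes `[γ]·[seg(A, ΔᵏA)]·[seg(ΔᵏA, Δᵏ⁺¹A)]` and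
`[γ]·[seg(A, Δᵏ⁺¹A)]` being equal (segments on the unipotent line), so that W applies. [cite: GompfAGT2010, Thm 2.1 (the general case follows from the case k = 1) and §4 ¶3] -/
theorem nonempty_diffeomorph_gompfSphere_deltaLeft_succ
    (h1 : ∀ (B : Matrix.SpecialLinearGroup (Fin 3) ℤ), IsGompfStandardForm B →
      ((B : Matrix (Fin 3) (Fin 3) ℤ) - 1).det = 1 → ∀ (β : SmoothMatrixPath (slRealMatrix B)),
        Nonempty (gompfSphere B β ≃ₘ⟮𝓡 4, 𝓡 4⟯
          gompfSphere (gompfDelta ^ (1 : ℤ) * B) (β.deltaLeft 1)))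
    (hA : IsGompfStandardForm A) (hdet : ((A : Matrix (Fin 3) (Fin 3) ℤ) - 1).det = 1)
    (γ : SmoothMatrixPath (slRealMatrix A)) (k : ℤ) :
    Nonempty (gompfSphere (gompfDelta ^ k * A) (γ.deltaLeft k) ≃ₘ⟮𝓡 4, 𝓡 4⟯
      gompfSphere (gompfDelta ^ (k + 1) * A) (γ.deltaLeft (k + 1))) := by
  have hB : IsGompfStandardForm (gompfDelta ^ k * A) := hA.gompfDelta_zpow_mul k
  have hdetB : (((gompfDelta ^ k * A : Matrix.SpecialLinearGroup (Fin 3) ℤ) :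
      Matrix (Fin 3) (Fin 3) ℤ) - 1).det = 1 := by
    rw [hA.det_gompfDelta_zpow_mul_sub_one]; exact hdet
  have e : gompfDelta ^ (1 : ℤ) * (gompfDelta ^ k * A) = gompfDelta ^ (k + 1) * A := by
    rw [← mul_assoc, ← _root_.zpow_add, add_comm]
  refine nonempty_diffeomorph_trans (h1 _ hB hdetB (γ.deltaLeft k)) (nonempty_diffeomorph_trans
    (nonempty_diffeomorph_gompfSphere_along ((γ.deltaLeft k).deltaLeft 1) e)
    (gompf2010_straightening_invariance_holds _ _ _ (Path.Homotopic.Quotient.eq.1 ?_)))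
  have hk1 : ∀ t ∈ I, 0 < ((1 - t) • (slPoint (gompfDelta ^ k * A)).1 +
      t • (slPoint (gompfDelta ^ (k + 1) * A)).1).det := by
    rw [← e]; exact det_segment_gompfDelta_zpow_mul _ _
  rw [(γ.deltaLeft k).mk_toPath_deltaLeft 1 e hk1]
  have h₀ := γ.mk_toPath_deltaLeft k rfl (det_segment_gompfDelta_zpow_mul A k)
  have h₁ := γ.mk_toPath_deltaLeft (k + 1) rfl (det_segment_gompfDelta_zpow_mul A (k + 1))
  rw [SmoothMatrixPath.along_rfl] at h₀ h₁
  rw [h₀, h₁, Path.Homotopic.Quotient.trans_assoc,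
    mk_segmentPath_trans_of_gompfDelta_zpow_mul A (a := 0) (by rw [zpow_zero, one_mul]) rfl rfl]

/-- **The framed row move for every `k ∈ ℤ` from the single move `A ↦ Δ A`** (induction on `k`,
both directions, from `k = 0` where the path `γ·τ₀` is `γ` followed by a constant segment). [cite: GompfAGT2010, Thm 2.1 (the general case follows from the case k = 1) and §4 ¶3] -/
theorem nonempty_diffeomorph_gompfSphere_deltaLeft_of_one
    (h1 : ∀ (B : Matrix.SpecialLinearGroup (Fin 3) ℤ), IsGompfStandardForm B →
      ((B : Matrix (Fin 3) (Fin 3) ℤ) - 1).det = 1 → ∀ (β : SmoothMatrixPath (slRealMatrix B)),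
        Nonempty (gompfSphere B β ≃ₘ⟮𝓡 4, 𝓡 4⟯
          gompfSphere (gompfDelta ^ (1 : ℤ) * B) (β.deltaLeft 1)))
    (hA : IsGompfStandardForm A) (hdet : ((A : Matrix (Fin 3) (Fin 3) ℤ) - 1).det = 1)
    (γ : SmoothMatrixPath (slRealMatrix A)) (k : ℤ) :
    Nonempty (gompfSphere A γ ≃ₘ⟮𝓡 4, 𝓡 4⟯ gompfSphere (gompfDelta ^ k * A) (γ.deltaLeft k)) := by
  induction k using Int.induction_on with
  | zero =>
    have e : A = gompfDelta ^ (0 : ℤ) * A := by rw [zpow_zero, one_mul]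
    refine nonempty_diffeomorph_trans (nonempty_diffeomorph_gompfSphere_along γ e)
      (gompf2010_straightening_invariance_holds _ _ _ (Path.Homotopic.Quotient.eq.1 ?_))
    have h₀ := γ.mk_toPath_deltaLeft 0 rfl (det_segment_gompfDelta_zpow_mul A 0)
    rw [SmoothMatrixPath.along_rfl] at h₀
    rw [h₀, γ.mk_toPath_along e (det_segment_gompfDelta_zpow_mul A 0)]
  | succ k ih =>
    exact nonempty_diffeomorph_trans ih
      (nonempty_diffeomorph_gompfSphere_deltaLeft_succ A h1 hA hdet γ k)
  | pred k ih =>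
    obtain ⟨e⟩ := nonempty_diffeomorph_gompfSphere_deltaLeft_succ A h1 hA hdet γ (-(k : ℤ) - 1)
    rw [sub_add_cancel] at e
    exact nonempty_diffeomorph_trans ih ⟨e.symm⟩

/-- **F from the single framed row move `A ↦ Δ A`.** [cite: GompfAGT2010, Thm 2.1 and §4 ¶3 (X^{τ·σ}_B = X^σ_A for B = Δᵏ A or A Δᵏ)] -/
theorem gompf2010_framedTwist_of_one
    (h1 : ∀ (B : Matrix.SpecialLinearGroup (Fin 3) ℤ), IsGompfStandardForm B →
      ((B : Matrix (Fin 3) (Fin 3) ℤ) - 1).det = 1 → ∀ (β : SmoothMatrixPath (slRealMatrix B)),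
        Nonempty (gompfSphere B β ≃ₘ⟮𝓡 4, 𝓡 4⟯
          gompfSphere (gompfDelta ^ (1 : ℤ) * B) (β.deltaLeft 1))) :
    gompf2010_framedTwist :=
  gompf2010_framedTwist_of_left fun A hA hdet γ k ↦
    nonempty_diffeomorph_gompfSphere_deltaLeft_of_one A h1 hA hdet γ k

/-- **Gompf 2010, Theorem 4.3, from the single framed row move `A ↦ Δ A`**: if for every `B` in
standard form with `det (B - 1) = 1` and every framing path `β`,
`gompfSphere B β ≃ₘ gompfSphere (Δ B) (β.deltaLeft 1)` — Theorem 2.1 with `k = 1` for the Dehn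
twist `δ ≃ Δ`, framed —, then all `X^σ_{A₀}` are diffeomorphic. [cite: GompfAGT2010, Thm 4.3] -/
theorem gompf2010_thm43_of_rowMove_one
    (h1 : ∀ (B : Matrix.SpecialLinearGroup (Fin 3) ℤ), IsGompfStandardForm B →
      ((B : Matrix (Fin 3) (Fin 3) ℤ) - 1).det = 1 → ∀ (β : SmoothMatrixPath (slRealMatrix B)),
        Nonempty (gompfSphere B β ≃ₘ⟮𝓡 4, 𝓡 4⟯
          gompfSphere (gompfDelta ^ (1 : ℤ) * B) (β.deltaLeft 1))) :
    gompf2010_thm43 :=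
  gompf2010_thm43_of_framedTwist (gompf2010_framedTwist_of_one h1)

end RowLine

end Literature.Topology.FourManifolds

/-! ### Assembly -/

namespace Literature.Topology.FourManifolds

universe w

variable (X : Type w) [TopologicalSpace X] [T2Space X] [SecondCountableTopology X]
  [ChartedSpace (EuclideanSpace ℝ (Fin 4)) X] [IsManifold (𝓡 4) ∞ X] [CompactSpace X]

/-- **The current leaf set: the framed row move and [AK1].** Every Cappell–Shaneson sphere of
every `Aₘ`, either framing, is `S⁴` (Gompf 2010, Examples 3.1(a)), from the framed Theorem 2.1 for
the single row move `A ↦ Δᵏ A` on matrices in standard form and [AK1]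
(`akbulutKirby1979_linearStraightening`). [cite: GompfAGT2010, Examples 3.1(a)] -/
theorem nonempty_diffeomorph_sphere_four_of_isCappellShanesonSphereOf_of_leftTwist_AK
    (hF : ∀ (A : Matrix.SpecialLinearGroup (Fin 3) ℤ), IsGompfStandardForm A →
      ((A : Matrix (Fin 3) (Fin 3) ℤ) - 1).det = 1 →
      ∀ (γ : SmoothMatrixPath (slRealMatrix A)) (k : ℤ),
        Nonempty (gompfSphere A γ ≃ₘ⟮𝓡 4, 𝓡 4⟯ gompfSphere (gompfDelta ^ k * A) (γ.deltaLeft k)))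
    (hAK : akbulutKirby1979_linearStraightening) :
    nonempty_diffeomorph_sphere_four_of_isCappellShanesonSphereOf X :=
  nonempty_diffeomorph_sphere_four_of_isCappellShanesonSphereOf_of_framedTwist_AK X
    (gompf2010_framedTwist_of_left hF) hAK

/-- **The current leaf set: the single framed row move `A ↦ Δ A` and [AK1].** [cite: GompfAGT2010, Examples 3.1(a)] -/
theorem nonempty_diffeomorph_sphere_four_of_isCappellShanesonSphereOf_of_rowMove_one_AK
    (h1 : ∀ (B : Matrix.SpecialLinearGroup (Fin 3) ℤ), IsGompfStandardForm B →
      ((B : Matrix (Fin 3) (Fin 3) ℤ) - 1).det = 1 → ∀ (β : SmoothMatrixPath (slRealMatrix B)),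
        Nonempty (gompfSphere B β ≃ₘ⟮𝓡 4, 𝓡 4⟯
          gompfSphere (gompfDelta ^ (1 : ℤ) * B) (β.deltaLeft 1)))
    (hAK : akbulutKirby1979_linearStraightening) :
    nonempty_diffeomorph_sphere_four_of_isCappellShanesonSphereOf X :=
  nonempty_diffeomorph_sphere_four_of_isCappellShanesonSphereOf_of_framedTwist_AK X
    (gompf2010_framedTwist_of_one h1) hAK

end Literature.Topology.FourManifolds
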